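import Mathlib
import HarnessLib

/-!
# Route `IntegerScrew` — the one-prime operator of the von Mangoldt coupling matrix has the EXACT spectrum
# `(j + 1/(p−1))·log p` (the prime-parity ladder, PIVOT-LAW §13.8 (b))

PIVOT-LAW §13.8/§13.10 (HOME/pivot/): conjugated by `diag(k^{-1/2})`, the von Mangoldt coupling matrix `N_M`
is `(log M − γ)·I + ℒ_M + ℰ_M` with `ℒ_M` the generator of the reversible random multiplicative walk
«`k → k p^a` at rate `log p/p^a`, `k → k/p^a` at rate `log p`»; in valuation coordinates the walk is (up to the
budget `k ≤ M`) a product of independent ONE-PRIME chains, and `−ℒ_p = T_p` acts on functions of `v = v_p(k)` by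

  `(T_p φ)(v) = log p · [ (1/(p−1) + v)·φ(v) − Σ_{a ≥ 1} p^{-a} φ(v + a) − Σ_{1 ≤ a ≤ v} φ(v − a) ]`.

This file proves the exact eigen-relation found numerically and then by hand in §13.8 (b): for every real
`p > 1` and every `j ≥ 1`, the PRIME-PARITY function

  `φ_{p,j}(v) = 𝟙[v = j − 1] − (p − 1)·𝟙[v ≥ j]`

satisfies `T_p φ_{p,j} = (j + 1/(p−1))·log p · φ_{p,j}` pointwise (`ladderVec_eigen`), the up-sum being the
convergent geometric-type series `Σ_{a ≥ 1} p^{-a} φ(v+a)` (`hasSum_ladderVec_up`: `= −1` if `v ≥ j − 1`,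
`= 0` if `v < j − 1`) and the down-sum the finite sum `Σ_{w < v} φ(w)` (`sum_ladderVec_down`).  With
`φ_{p,0} ≡ 1` (eigenvalue `0`) these give the ladder `{log M − γ − Σ_p (j_p + 1/(p−1)) log p}` at the top of
`spec(N_M)` (§13.8 (b), measured on 24 levels, blind test 4/4) and identify the first excited states with the
coefficient vectors of `(1 − p^{1−s})ζ(s)` = THEOREM 7's intercept polynomials.  RH-free, elementary; nothing
here bears on the truth of RH.

References: M. Suzuki, J. Lond. Math. Soc. (2) 108 (2023) 1448–1487 [Suzuki2023] (the screw matrices whose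
intercept energy the coupling matrix controls); PIVOT-LAW §13.8, §13.10 (the walk and the ladder).
-/

noncomputable section

-- D-0017: `Summit.<S>.<S>.…` is the designed namespace of a single-problem summit.
set_option linter.dupNamespace false

namespace Summit.RiemannHypothesis.RiemannHypothesis.Theorems.IntegerScrew

open Finset Filter

/-- The prime-parity function of level `j ≥ 1` for the base `p`:
`φ_{p,j}(v) = 1` if `v = j − 1`, `= −(p − 1)` if `v ≥ j`, `= 0` if `v < j − 1`. -/
def ladderVec (p : ℝ) (j v : ℕ) : ℝ :=
  if v + 1 = j then 1 else if j ≤ v then -(p - 1) else 0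

/-- `φ_{p,j}(v) = 0` below the level, `v + 1 < j`. -/
theorem ladderVec_of_lt {p : ℝ} {j v : ℕ} (h : v + 1 < j) : ladderVec p j v = 0 := by
  unfold ladderVec
  rw [if_neg (by omega), if_neg (by omega)]

/-- `φ_{p,j}(j − 1) = 1`. -/
theorem ladderVec_of_eq {p : ℝ} {j v : ℕ} (h : v + 1 = j) : ladderVec p j v = 1 := by
  unfold ladderVec
  rw [if_pos h]

/-- `φ_{p,j}(v) = −(p − 1)` at and above the level, `j ≤ v`. -/
theorem ladderVec_of_le {p : ℝ} {j v : ℕ} (h : j ≤ v) : ladderVec p j v = -(p - 1) := by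
  unfold ladderVec
  rw [if_neg (by omega), if_pos h]

/-- THE UP-SUM (geometric): `Σ_{a ≥ 1} p^{-a} φ_{p,j}(v + a) = −1` if `j ≤ v + 1` and `= 0` if `v + 1 < j`
(for `p > 1`).  Indexing: the `a`-th term is `p^{-(a+1)} φ(v + a + 1)`, `a ≥ 0`. -/
theorem hasSum_ladderVec_up {p : ℝ} (hp : 1 < p) (j v : ℕ) :
    HasSum (fun a : ℕ => (1 / p) ^ (a + 1) * ladderVec p j (v + a + 1))
      (if j ≤ v + 1 then -1 else 0) := by
  have hp0 : 0 < p := by linarith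
  set r : ℝ := 1 / p with hr
  have hr0 : 0 ≤ r := by rw [hr]; positivity
  have hr1 : r < 1 := by rw [hr, div_lt_one hp0]; exact hp
  have hrp : r * p = 1 := by rw [hr]; field_simp
  -- the constant tail: ∑_{a ≥ 0} r^(a+1) · (−(p−1)) = −1
  have hgeom := hasSum_geometric_of_lt_one hr0 hr1
  have htail : HasSum (fun a : ℕ => r ^ (a + 1) * (-(p - 1))) (-1) := by
    have h := (hgeom.mul_left (r * (-(p - 1))))
    have hval : r * (-(p - 1)) * (1 - r)⁻¹ = -1 := by
      have h1r : 1 - r ≠ 0 := by linarith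
      field_simp
      nlinarith [hrp]
    rw [hval] at h
    refine h.congr_fun fun a => ?_
    ring
  by_cases hjv : j ≤ v + 1
  · rw [if_pos hjv]
    refine htail.congr_fun fun a => ?_
    rw [ladderVec_of_le (by omega)]
  · rw [if_neg hjv]
    have hjv : v + 1 < j := not_le.mp hjv
    -- shift by d := j − 1 − v ≥ 1 terms: the first d − 1 vanish, the d-th is r^d, then the constant tail
    set d : ℕ := j - 1 - v with hd
    have hd1 : 1 ≤ d := by omega
    -- tail after d terms: a ↦ r^(a+d+1)·(−(p−1)), summing to −r^d
    have htail' : HasSum (fun a : ℕ => (fun a : ℕ => r ^ (a + 1) * ladderVec p j (v + a + 1)) (a + d))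
        (-r ^ d) := by
      have h := htail.mul_left (r ^ d)
      have hval : r ^ d * (-1) = -r ^ d := by ring
      rw [hval] at h
      refine h.congr_fun fun a => ?_
      simp only
      rw [ladderVec_of_le (by omega)]
      ring
    have hfin : ∑ i ∈ range d, r ^ (i + 1) * ladderVec p j (v + i + 1) = r ^ d := by
      obtain ⟨e, he⟩ : ∃ e, d = e + 1 := ⟨d - 1, by omega⟩
      rw [he, sum_range_succ]
      have hzero : ∑ i ∈ range e, r ^ (i + 1) * ladderVec p j (v + i + 1) = 0 := by
        refine sum_eq_zero fun i hi => ?_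
        rw [ladderVec_of_lt (by have := mem_range.1 hi; omega), mul_zero]
      rw [hzero, ladderVec_of_eq (by omega), zero_add, mul_one]
    have h := (hasSum_nat_add_iff (f := fun a : ℕ => r ^ (a + 1) * ladderVec p j (v + a + 1)) d).1 htail'
    rw [hfin, neg_add_cancel] at h
    exact h

/-- THE DOWN-SUM (finite): `Σ_{w < v} φ_{p,j}(w) = 1 − (p−1)(v − j)` if `j ≤ v`, `= 0` if `v < j`. -/
theorem sum_ladderVec_down (p : ℝ) {j : ℕ} (hj : 1 ≤ j) (v : ℕ) :
    ∑ w ∈ range v, ladderVec p j w = if j ≤ v then 1 - (p - 1) * ((v : ℝ) - j) else 0 := by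
  induction v with
  | zero => simp [show ¬ j ≤ 0 by omega]
  | succ v ih =>
    rw [sum_range_succ, ih]
    by_cases h1 : j ≤ v
    · rw [if_pos h1, if_pos (by omega), ladderVec_of_le h1]
      push_cast
      ring
    · by_cases h2 : v + 1 = j
      · rw [if_neg h1, if_pos (by omega), ladderVec_of_eq h2]
        have : ((v + 1 : ℕ) : ℝ) - j = 0 := by rw [h2]; ring
        rw [this]; ring
      · rw [if_neg h1, if_neg (by omega), ladderVec_of_lt (by omega)]
        ring

/-- **The prime-parity ladder, exact** (PIVOT-LAW §13.8 (b)): for real `p > 1` and `j ≥ 1`, with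
`U(v) := Σ_{a ≥ 1} p^{-a} φ_{p,j}(v+a)` and `D(v) := Σ_{w < v} φ_{p,j}(w)`,
`(1/(p−1) + v)·φ_{p,j}(v) − U(v) − D(v) = (j + 1/(p−1))·φ_{p,j}(v)` for every `v` — i.e.
`T_p φ_{p,j} = (j + 1/(p−1))·log p·φ_{p,j}` for the one-prime operator of the multiplicative walk. -/
theorem ladderVec_eigen {p : ℝ} (hp : 1 < p) {j : ℕ} (hj : 1 ≤ j) (v : ℕ) :
    (1 / (p - 1) + v) * ladderVec p j v - (∑' a : ℕ, (1 / p) ^ (a + 1) * ladderVec p j (v + a + 1))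
        - ∑ w ∈ range v, ladderVec p j w = ((j : ℝ) + 1 / (p - 1)) * ladderVec p j v := by
  rw [(hasSum_ladderVec_up hp j v).tsum_eq, sum_ladderVec_down p hj v]
  have hp1 : p - 1 ≠ 0 := by linarith
  by_cases h1 : j ≤ v
  · rw [if_pos (by omega), if_pos h1, ladderVec_of_le h1]
    field_simp
    ring
  · by_cases h2 : v + 1 = j
    · rw [if_pos (by omega), if_neg h1, ladderVec_of_eq h2]
      have : (j : ℝ) = v + 1 := by rw [← h2]; push_cast; ring
      rw [this]
      ring
    · rw [if_neg (by omega), if_neg h1, ladderVec_of_lt (by omega)]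
      ring

/-- The same with the factor `log p`: `(T_p φ_{p,j})(v) = (j + 1/(p−1))·log p·φ_{p,j}(v)`. -/
theorem ladderVec_eigen_log {p : ℝ} (hp : 1 < p) {j : ℕ} (hj : 1 ≤ j) (v : ℕ) :
    Real.log p * ((1 / (p - 1) + v) * ladderVec p j v
      - (∑' a : ℕ, (1 / p) ^ (a + 1) * ladderVec p j (v + a + 1)) - ∑ w ∈ range v, ladderVec p j w) =
      ((j : ℝ) + 1 / (p - 1)) * Real.log p * ladderVec p j v := by
  rw [ladderVec_eigen hp hj v]
  ring

/-- The ground state: for the constant function the bracket vanishes,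
`(1/(p−1) + v)·1 − Σ_{a≥1} p^{-a} − v = 0` (`T_p 1 = 0`). -/
theorem ladder_ground {p : ℝ} (hp : 1 < p) (v : ℕ) :
    (1 / (p - 1) + v) * 1 - (∑' a : ℕ, (1 / p) ^ (a + 1) * (1 : ℝ)) - ∑ _w ∈ range v, (1 : ℝ) = 0 := by
  have hp0 : 0 < p := by linarith
  have hr0 : 0 ≤ 1 / p := by positivity
  have hr1 : 1 / p < 1 := by rw [div_lt_one hp0]; exact hp
  have h := hasSum_geometric_of_lt_one hr0 hr1
  have h' : HasSum (fun a : ℕ => (1 / p) ^ (a + 1) * (1 : ℝ)) (1 / (p - 1)) := by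
    have h2 := h.mul_left (1 / p)
    have hval : 1 / p * (1 - 1 / p)⁻¹ = 1 / (p - 1) := by
      have : p - 1 ≠ 0 := by linarith
      field_simp
    rw [hval] at h2
    refine h2.congr_fun fun a => ?_
    ring
  rw [h'.tsum_eq, sum_const, card_range]
  simp

end Summit.RiemannHypothesis.RiemannHypothesis.Theorems.IntegerScrew

end
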